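import Summits.CriticalPhenomena.SAWScalingLimit.Theses.SAWPtolemyBoundary
import Summits.CriticalPhenomena.SAWScalingLimit.Theses.SAWRestrictionRigidity

/-!
# Birth skeleton (BC3) for the crux `SAWPtolemyBoundary.RankOneBumps`

(crux item stmt-CriticalPhenomena-15264, rank 3 of `route-CriticalPhenomena-SAWPtolemyBoundary`, sub-problem
`SAWScalingLimit`; skeleton registrar planner-skel-stmt-CriticalPhenomena-15264-0, 2026-08-17; tree path
`Summits/CriticalPhenomena/SAWScalingLimit/Cruxes/RankOneBumps/Lines/birth.lean`.)

Crux (FIXED, by name): `RankOneBumps` — for a conformal rectangle `R = (Ω; u, v, w, ξ)` (marks `pt 0 … pt 3`),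
lattice approximations `q 0, q 1, q 2` of `u, v, w` pairwise joined in `Ω_δ` eventually, every `θ > 0` and
`η > 0`, there is `ε₀ > 0` such that for every conformal rectangle `R' ⊆ R` with the same `u, v, w`, obtained by
removing from `Ω` a bump inside `B(ξ, ε)` containing `Ω ∩ B(ξ, θε)`, `ε < ε₀`, EVENTUALLY IN `δ`:
`|√h₀₂ − √h₀₁ − √h₁₂| ≤ η √h₀₂`, where `h_ij(δ) = 1 − P_δ^{(Ω; q_i, q_j)}(curve ⊆ closure Ω')` is the
probability that the critical SAW chord of the BIG domain leaves the bumped one.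

## The line: AVOIDANCE LIMITS + WARD SQUARE KERNEL (2 registered stubs)

The crux is an eventual-in-`δ` inequality at relative precision between three bump-hitting probabilities.  The
skeleton cuts it at the mesh limit `δ → 0⁺`, into the germ-free EXISTENCE of that limit and the single-channel
STRUCTURE of the limit values:

* (S1) `stub_bumpAvoidanceLimits` — `BumpAvoidanceLimits` (lattice; L–XL, open): for every such `R, q` there is
  `ε₁ > 0` such that for every bumped `R'` (same `u, v, w`, bump inside `B(ξ, ε)`, `ε < ε₁`) and every pair
  `i < j` of the three marks, the avoidance probability `P_δ^{(Ω; q_i, q_j)}(curve ⊆ closure Ω')` CONVERGES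
  along the full filter `δ → 0⁺`.  This is the bump case of the open crux `AvoidanceCocycleLimit` of the sibling
  route `SAWRestrictionRigidity` (item stmt-CriticalPhenomena-1369: full-filter limits of `P_δ(curve ⊆ cl D')`
  for Dobrushin `D' ⊆ D` agreeing with `D` near both marked points — germ-free, so the Kennedy–Lawler boundary
  lattice factors cancel); the implication stmt-1369 ⇒ (S1) is PROVED below
  (`bumpAvoidanceLimits_of_avoidanceCocycleLimit`: the chord `(Ω; pt i, pt j)` of `R`, resp. `R'`, is a Dobrushin
  pair as required as soon as `ε < dist(pt k, ξ)` for `k = i, j`), so staffing stmt-1369 staffs (S1).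
* (S2) `stub_wardSquareKernel` — `WardSquareKernel` (continuum content; L, the heart): the limiting bump
  response has the single-channel Ward form.  For every `R, q` there are CHARGES `G : Fin 3 → ℝ`, strictly
  monotone along `u, v, w` and independent of the bump, such that for every `θ > 0`, `η > 0` there is `ε₀ > 0`
  such that every `θ`-non-degenerate `ε`-bump `R'` at `ξ` with `ε < ε₀` carries an AMPLITUDE `α(R') > 0`,
  independent of the pair, with `|(1 − c_ij) − α (G_j − G_i)²| ≤ η · α (G_j − G_i)²` for every pair `i < j` and
  every full-filter limit `c_ij` of the avoidance probability (vacuous where no limit exists; (S1) supplies it).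
  In words: the matrix of limiting hitting probabilities (bumps × pairs) is asymptotically RANK ONE, bump ↦ `α`,
  pair ↦ `(G_j − G_i)²`, and the pair kernel is the square of a difference of charges.  For SLE(8/3) this is the
  small-hull expansion of the restriction formula `P(avoid A) = (Φ_A′(X_i)Φ_A′(X_j)(X_i − X_j)²/(Φ_A(X_i) −
  Φ_A(X_j))²)^{5/8}` (LSW03 Thm 6.1 in covariant form): with `g_A(z) = z + a₁/(z − X_ξ) + a₂/(z − X_ξ)² + …`,
  `1 − P = (5/8)·a₁·(F_i − F_j)²·(1 + O(rad A))`, `F = 1/(X − X_ξ)` (so `G = ∓F`, `α = (5/8)a₁`), and the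
  correction is RELATIVE to `a₁` because the higher coefficients of the hull map are moments of a positive
  measure of mass `a₁ = hcap A` supported within `O(rad A)` of `X_ξ` (`|a₂| ≤ 2 rad(A)·a₁`; Lawler 2005 §3.4):
  no `θ`-condition is needed in the continuum beyond `hcap > 0`, which the `θ`-ball inside the bump
  guarantees.  Heuristically, equivalently: the boundary-arm exponent of the limit is `8/κ − 1 = 2` AND its
  boundary Green function has the Möbius three-point form `((X_j − X_i)/((X_ξ − X_i)(X_ξ − X_j)))²` — the
  `κ = 8/3` fingerprint (for SLE_κ the `(8/κ − 1)`-th roots, not the square roots, would be additive).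

Composition `RankOneBumps_of : (S1) → (S2) → RankOneBumps` (kernel-checked, sorry-free, ~80 lines of real
analysis): with slack `η' = min(η/8, 1/2)` and `ε₀ = min(ε₁(S1), ε₀(S2, θ, η'))`, the three limits
`L_ij = 1 − c_ij` exist (S1; `c_ij ≤ 1` so `toReal` is continuous there) and satisfy
`|L_ij − α g_ij²| ≤ η' α g_ij²` with `g₀₂ = g₀₁ + g₁₂ > 0` (S2, strict monotonicity of `G`); the RANK-ONE ALGEBRA
`sqrt_additive_of_square_kernel` gives `0 < L₀₂` and `|√L₀₂ − √L₀₁ − √L₁₂| ≤ 4η′√L₀₂ < η√L₀₂`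
(`√(1+η′) − √(1−η′) ≤ 2η′`, `√(1−η′) ≥ 1/2`), and a STRICT inequality between the limits of two functions of
`δ` holds eventually (`Filter.Tendsto.eventually_lt`).  Positivity `L₀₂ > 0` ("a non-degenerate bump is felt in
the limit") is where the argument would break without (S2)'s lower bound: if all `h_ij → 0` the crux is a
statement about RATES, which limits alone cannot decide.

Why this cut: (S1) is exactly the part of the difficulty this route SHARES with its siblings (existence and
approximation-independence of germ-free avoidance limits — "as hard as uniqueness of a scalar scaling limit",
stmt-1369's why-might-fail) and is already an item; (S2) is the part PROPER to this crux — the c = 0 /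
single-weight-2-channel bet of the route header ("rank one is the boundary stress-tensor Ward identity in
disguise; a logarithmic partner of T could enter at the same order") now isolated as a statement about limit
VALUES only, free of lattice bookkeeping, and carrying visibly more structure than the crux (bump-independent
charges, pair-independent amplitude, positivity) — it is the crux "at δ = 0⁺" plus convergence of the response
RATIOS `L₀₁ : L₁₂ : L₀₂` as the bump shrinks, not a rewording of it (BC3 probes below: no cheap implication
either way).  Both stubs are stated in TREE VOCABULARY ONLY and land verbatim as
`Theorems/SAWPtolemyBoundaryRankOneBumps<Stub>.lean --supports stmt-CriticalPhenomena-15264`.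

Negatives honoured: no `Disproof.lean` exists for this crux (`ledger crux ls stmt-CriticalPhenomena-15264`: no
workfiles before this one); `ledger negatives --problem CriticalPhenomena` (11 entries, 2026-08-17): the only
SAW-curve-law entry is the all-`δ` tightness stmt-0772 — neither stub asserts tightness or any all-`δ`
statement (both speak of full-filter LIMITS only, and (S2) is vacuous where a limit fails to exist); no stub
asserts a VALUE of an exponent or a conformal map (barriers `NienhuisWeightsExcludeVertexSAW`,
`SAWNoUnitaryCFT` not engaged: no parafermionic observable, no positivity/unitarity of a CFT is used — the
"single channel" is a statement about three probabilities).

BC3 AUDIT + PROBES (registrar, 2026-08-17): `lean check --json` rc 0, errors [], sorries 2 = the two `stub_*`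
declarations (warnings "declaration uses sorry" at exactly those two), zero elsewhere; `ledger skeleton check
… --crux stmt-CriticalPhenomena-15264`: OK — `RankOneBumps_of` concludes the route decl BY NAME under exactly the
two `__Registered.stub_*` hypotheses, stubs registered `stub_bumpAvoidanceLimits`, `stub_wardSquareKernel`.
Probes (`bc/probe_<Stub>_{crux,summit}.lean` in the registrar's folder: the combined
`first | exact? | simpa [Def] | (unfold Def; simpa) | aesop` AND the four alternatives one by one,
`maxHeartbeats 400000`, the stub re-declared as a `def` with no sorried theorem in scope): for each of the two
stubs against BOTH `RankOneBumps` and `SAWScalingLimit`, every example FAILS (20/20: `exact?` "could not close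
the goal"; `simpa` / `unfold; simpa` "Tactic `assumption` failed" with the implication as residual goal; `aesop`
"failed to prove the goal after exhaustive search"; combined: unsolved goals).  Informational (`bc/probe_extra.lean`,
8/8 fail): the converses `RankOneBumps → stub`, `SAWScalingLimit → stub`, the dedup `stub` by `exact? | aesop`,
and `stub₁ ↔ stub₂` in both directions.  No stub is cheaply the crux, the summit, a known theorem, or the other
stub.  Details: `Lines/birth.md`.
-/

noncomputable section

open MeasureTheory Filter Topology Set
open Literature.Probability.RandomPlanarGeometry Literature.Probability.LatticeModels

namespace Summit.CriticalPhenomena.SAWScalingLimit.Cruxes.RankOneBumps.Birth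

/-! ## 1. The two statements of the line (tree vocabulary only) -/

/-- **(S1) Germ-free bump-avoidance limits** (`BumpAvoidanceLimits`).  For a conformal rectangle
`R = (Ω; u, v, w, ξ)` and lattice approximations `q 0, q 1, q 2` of `u, v, w` pairwise joined in `Ω_δ`
eventually, there is `ε₁ > 0` such that for every conformal rectangle `R' ⊆ R` with the same `u, v, w` whose
complement in `Ω` lies inside `B(ξ, ε)`, `ε < ε₁`, and every pair `i < j` of the three marks, the probability
that the critical SAW chord of `(Ω_δ; q_i, q_j)` stays in `closure Ω'` converges as `δ → 0⁺` along the FULL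
filter (no claim on the value).  The bump case of `SAWRestrictionRigidity.AvoidanceCocycleLimit`
(stmt-CriticalPhenomena-1369), see `bumpAvoidanceLimits_of_avoidanceCocycleLimit`. -/
def BumpAvoidanceLimits : Prop :=
  ∀ (R : ConformalRectangle) (q : Fin 3 → ℝ → Site 2),
    (∀ i : Fin 3, Tendsto (fun δ => meshPoint δ (q i δ)) (𝓝[>] (0 : ℝ)) (𝓝 (R.pt i.castSucc))) →
    (∀ i j : Fin 3, i ≠ j → ∀ᶠ δ in 𝓝[>] (0 : ℝ),
      (discreteDomainGraph R.carrier δ).Reachable (q i δ) (q j δ)) →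
    ∃ ε₁ : ℝ, 0 < ε₁ ∧
      ∀ (R' : ConformalRectangle) (ε : ℝ), 0 < ε → ε < ε₁ → R'.carrier ⊆ R.carrier →
        (∀ i : Fin 3, R'.pt i.castSucc = R.pt i.castSucc) →
        R.carrier \ R'.carrier ⊆ Metric.ball (R.pt 3) ε →
        ∀ i j : Fin 3, i < j → ∃ c : ENNReal,
          Tendsto (fun δ => ((SAW.law R.carrier δ (q i δ) (q j δ)).map (fun γ => γ.curve))
            (CurveClass.rangeSubset (closure R'.carrier))) (𝓝[>] (0 : ℝ)) (𝓝 c)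

/-- **(S2) Ward square kernel of the limiting bump response** (`WardSquareKernel`; the single weight-2
channel).  For `R, q` as above there are charges `G : Fin 3 → ℝ`, strictly increasing along `u, v, w` and
independent of the bump, such that for every `θ > 0`, `η > 0` there is `ε₀ > 0` such that for every conformal
rectangle `R' ⊆ R` with the same `u, v, w`, obtained by removing from `Ω` a bump inside `B(ξ, ε)` containing
`Ω ∩ B(ξ, θε)`, `ε < ε₀`, there is an amplitude `α > 0` (depending on the bump, not on the pair) with
`|(1 − c) − α (G j − G i)²| ≤ η · α (G j − G i)²` for every pair `i < j` and every full-filter limit `c` of the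
avoidance probability `P_δ^{(Ω; q_i, q_j)}(curve ⊆ closure Ω')`.  SLE(8/3) value (`φ : Ω → ℍ`):
`G = ∓1/(φ(·) − φ(ξ))`, `α = (5/8)·hcap(φ(bump))`, relative error `O(rad φ(bump))` (module docstring). -/
def WardSquareKernel : Prop :=
  ∀ (R : ConformalRectangle) (q : Fin 3 → ℝ → Site 2),
    (∀ i : Fin 3, Tendsto (fun δ => meshPoint δ (q i δ)) (𝓝[>] (0 : ℝ)) (𝓝 (R.pt i.castSucc))) →
    (∀ i j : Fin 3, i ≠ j → ∀ᶠ δ in 𝓝[>] (0 : ℝ),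
      (discreteDomainGraph R.carrier δ).Reachable (q i δ) (q j δ)) →
    ∃ G : Fin 3 → ℝ, StrictMono G ∧
      ∀ θ : ℝ, 0 < θ → ∀ η : ℝ, 0 < η → ∃ ε₀ : ℝ, 0 < ε₀ ∧
        ∀ (R' : ConformalRectangle) (ε : ℝ), 0 < ε → ε < ε₀ → R'.carrier ⊆ R.carrier →
          (∀ i : Fin 3, R'.pt i.castSucc = R.pt i.castSucc) →
          R.carrier \ R'.carrier ⊆ Metric.ball (R.pt 3) ε →
          R.carrier ∩ Metric.ball (R.pt 3) (θ * ε) ⊆ R.carrier \ R'.carrier →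
          ∃ α : ℝ, 0 < α ∧ ∀ i j : Fin 3, i < j → ∀ c : ENNReal,
            Tendsto (fun δ => ((SAW.law R.carrier δ (q i δ) (q j δ)).map (fun γ => γ.curve))
              (CurveClass.rangeSubset (closure R'.carrier))) (𝓝[>] (0 : ℝ)) (𝓝 c) →
            |(1 - c.toReal) - α * (G j - G i) ^ 2| ≤ η * (α * (G j - G i) ^ 2)

/-! ## 2. Registered stubs (the ONLY `sorry`s of this file; statements LITERAL, in tree vocabulary, so that
each lands verbatim as a `Theorems/…` file `--supports stmt-CriticalPhenomena-15264`; provers need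
`open MeasureTheory Filter Topology Literature.Probability.RandomPlanarGeometry Literature.Probability.LatticeModels`
for the text to elaborate as written) -/

/-- **STUB S1 (L–XL, open) — `BumpAvoidanceLimits`, literal.**  Why plausibly true: `P_δ(curve ⊆ cl Ω') =
Z_δ(Ω'; q_i, q_j)/Z_δ(Ω; q_i, q_j)` up to largest-component bookkeeping (configurational measure, exact
lattice restriction; tree: `SAWRestrictionCovariance.lean`), `Ω'` agrees with `Ω` near both endpoints (the bump sits at the fourth mark `ξ`), so the Kennedy–Lawler
boundary lattice factors of numerator and denominator are the same and the conjectured limit is the conformal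
quantity `(Φ′(X_i)Φ′(X_j)(X_i−X_j)²/(Φ(X_i)−Φ(X_j))²)^{5/8}` of LSW03/LSW04 — but only EXISTENCE of the limit is
asserted.  Why it might fail / why it is not cheap: a full-filter limit of a ratio of critical SAW generating
functions with no monotonicity in `δ` — "as hard as uniqueness of a scalar scaling limit; even existence is not
in print" (why-might-fail of stmt-1369, of which this is the bump case:
`bumpAvoidanceLimits_of_avoidanceCocycleLimit`).  Sources: LawlerSchrammWerner2004SAW (arXiv:math/0204277
§3.4.5, §4.1), KennedyLawler2013 (arXiv:1109.3091), LawlerSchrammWerner2003Restriction. -/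
theorem stub_bumpAvoidanceLimits :
    ∀ (R : ConformalRectangle) (q : Fin 3 → ℝ → Site 2),
    (∀ i : Fin 3, Tendsto (fun δ => meshPoint δ (q i δ)) (𝓝[>] (0 : ℝ)) (𝓝 (R.pt i.castSucc))) →
    (∀ i j : Fin 3, i ≠ j → ∀ᶠ δ in 𝓝[>] (0 : ℝ),
      (discreteDomainGraph R.carrier δ).Reachable (q i δ) (q j δ)) →
    ∃ ε₁ : ℝ, 0 < ε₁ ∧
      ∀ (R' : ConformalRectangle) (ε : ℝ), 0 < ε → ε < ε₁ → R'.carrier ⊆ R.carrier →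
        (∀ i : Fin 3, R'.pt i.castSucc = R.pt i.castSucc) →
        R.carrier \ R'.carrier ⊆ Metric.ball (R.pt 3) ε →
        ∀ i j : Fin 3, i < j → ∃ c : ENNReal,
          Tendsto (fun δ => ((SAW.law R.carrier δ (q i δ) (q j δ)).map (fun γ => γ.curve))
            (CurveClass.rangeSubset (closure R'.carrier))) (𝓝[>] (0 : ℝ)) (𝓝 c) := by
  sorry

/-- **STUB S2 (L; the heart of the crux) — `WardSquareKernel`, literal.**  Why plausibly true: for the
conjectured limit SLE(8/3) it is the small-hull expansion of the restriction formula (LSW03 Thm 6.1, tree: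
`sle_restriction_eightThirds`, in the covariant two-endpoint form) — `1 − P(avoid A) = (5/8)·hcap(A)·(F_i −
F_j)²·(1 + O(rad A))`, `F = 1/(X − X_ξ)`, with a RELATIVE error by the Nevanlinna representation of the hull
map; only `hcap(A) > 0` is needed, which the `θ`-ball inside the bump provides.  A lattice-intrinsic route to
it: restriction covariance makes the limits a multiplicative cocycle over nested domains, the response to a
shrinking bump factorises as (probability to come `ε`-close to `ξ`) × (conditional probability to hit the bump),
the second factor forgetting the far endpoints (local/global decoupling at a boundary point) — rank one — and
the first being the boundary Green function with arm exponent `2` in Möbius three-point form — the square.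
Why it might fail: exactly the crux's why-might-fail — the rank-one/square form is the boundary stress-tensor
Ward identity in disguise (single weight-2 channel); a `c = 0` logarithmic partner of `T`, or a limit that is
scale- but not Möbius-covariant, would add a second channel at the same order; uniformity of `ε₀` over bump
SHAPES rests on the relative (`O(rad A)`) form of the correction.  Sources: LawlerSchrammWerner2003Restriction
(arXiv:math/0209343 Thm 6.1, §5), FriedrichWerner2003 (arXiv:math-ph/0301018), DoyonRivaCardy2006,
Lawler2015 boundary Minkowski content (arXiv:1403.1945). -/
theorem stub_wardSquareKernel :
    ∀ (R : ConformalRectangle) (q : Fin 3 → ℝ → Site 2),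
    (∀ i : Fin 3, Tendsto (fun δ => meshPoint δ (q i δ)) (𝓝[>] (0 : ℝ)) (𝓝 (R.pt i.castSucc))) →
    (∀ i j : Fin 3, i ≠ j → ∀ᶠ δ in 𝓝[>] (0 : ℝ),
      (discreteDomainGraph R.carrier δ).Reachable (q i δ) (q j δ)) →
    ∃ G : Fin 3 → ℝ, StrictMono G ∧
      ∀ θ : ℝ, 0 < θ → ∀ η : ℝ, 0 < η → ∃ ε₀ : ℝ, 0 < ε₀ ∧
        ∀ (R' : ConformalRectangle) (ε : ℝ), 0 < ε → ε < ε₀ → R'.carrier ⊆ R.carrier →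
          (∀ i : Fin 3, R'.pt i.castSucc = R.pt i.castSucc) →
          R.carrier \ R'.carrier ⊆ Metric.ball (R.pt 3) ε →
          R.carrier ∩ Metric.ball (R.pt 3) (θ * ε) ⊆ R.carrier \ R'.carrier →
          ∃ α : ℝ, 0 < α ∧ ∀ i j : Fin 3, i < j → ∀ c : ENNReal,
            Tendsto (fun δ => ((SAW.law R.carrier δ (q i δ) (q j δ)).map (fun γ => γ.curve))
              (CurveClass.rangeSubset (closure R'.carrier))) (𝓝[>] (0 : ℝ)) (𝓝 c) →
            |(1 - c.toReal) - α * (G j - G i) ^ 2| ≤ η * (α * (G j - G i) ^ 2) := by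
  sorry

/-- Definitional consistency: the literal text of STUB S1 is the named statement `BumpAvoidanceLimits`. -/
theorem bumpAvoidanceLimits_holds : BumpAvoidanceLimits := stub_bumpAvoidanceLimits

/-- Definitional consistency: the literal text of STUB S2 is the named statement `WardSquareKernel`. -/
theorem wardSquareKernel_holds : WardSquareKernel := stub_wardSquareKernel

/-! ### Name-keyed aliases of the two statements — the hypotheses of `RankOneBumps_of`

The skeleton audit (`#h21_check_skeleton`) admits a hypothesis of the skeleton theorem only if its head constant
is a registered obligation or is NAMED like a declared stub; `__Registered.stub_X` is the statement of `stub_X`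
under that name (device of `Cruxes/AxiomsOfLimit/Lines/birth.lean`).  Each alias is definitionally its statement. -/
namespace __Registered

/-- Alias of `BumpAvoidanceLimits` keyed by the registered stub name. -/
abbrev stub_bumpAvoidanceLimits : Prop := BumpAvoidanceLimits
/-- Alias of `WardSquareKernel` keyed by the registered stub name. -/
abbrev stub_wardSquareKernel : Prop := WardSquareKernel

end __Registered

/-! ## 3. Sorry-free glue -/

/-- A sub-domain obtained by removing a bump inside `B(ξ, ε)` agrees with the domain on every ball
`B(u, ε')` with `ε + ε' ≤ dist u ξ`. -/
theorem inter_ball_eq_of_diff_subset_ball {R R' : Set ℂ} {ξ u : ℂ} {ε ε' : ℝ}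
    (hsub : R' ⊆ R) (hball : R \ R' ⊆ Metric.ball ξ ε) (h : ε + ε' ≤ dist u ξ) :
    R' ∩ Metric.ball u ε' = R ∩ Metric.ball u ε' := by
  ext x
  simp only [Set.mem_inter_iff, Metric.mem_ball]
  constructor
  · rintro ⟨hx, hxu⟩
    exact ⟨hsub hx, hxu⟩
  · rintro ⟨hx, hxu⟩
    refine ⟨?_, hxu⟩
    by_contra hx'
    have hxξ : dist x ξ < ε := hball ⟨hx, hx'⟩
    have htri := dist_triangle u x ξ
    rw [dist_comm u x] at htri
    linarith

/-- Avoidance probabilities are at most one (the SAW law has total mass `≤ 1`, junk cases included). -/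
theorem map_law_apply_le_one (Ω : Set ℂ) (δ : ℝ) (a b : Site 2) (S : Set (CurveClass ℂ)) :
    ((SAW.law Ω δ a b).map (fun γ => γ.curve)) S ≤ 1 := by
  calc ((SAW.law Ω δ a b).map (fun γ => γ.curve)) S
      ≤ ((SAW.law Ω δ a b).map (fun γ => γ.curve)) Set.univ := measure_mono (Set.subset_univ _)
    _ = SAW.law Ω δ a b Set.univ := by
        rw [Measure.map_apply (SAW.DomainSAW.measurable_of_top _) MeasurableSet.univ, Set.preimage_univ]
    _ ≤ 1 := by
        rw [SAW.law, Measure.smul_apply, smul_eq_mul]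
        exact ENNReal.inv_mul_le_one _

/-- A full-filter limit of avoidance probabilities is finite (`≤ 1`). -/
theorem ne_top_of_tendsto_avoid {Ω : Set ℂ} {a b : ℝ → Site 2} {S : Set (CurveClass ℂ)} {c : ENNReal}
    (hc : Tendsto (fun δ => ((SAW.law Ω δ (a δ) (b δ)).map (fun γ => γ.curve)) S) (𝓝[>] (0 : ℝ)) (𝓝 c)) :
    c ≠ ⊤ :=
  ne_top_of_le_ne_top ENNReal.one_ne_top (le_of_tendsto' hc fun _ => map_law_apply_le_one _ _ _ _ _)

/-- **stmt-1369 ⇒ (S1).**  The open crux `AvoidanceCocycleLimit` of the sibling route `SAWRestrictionRigidity`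
(full-filter avoidance limits for Dobrushin `D' ⊆ D` with the same marks agreeing with `D` near both of them)
implies `BumpAvoidanceLimits`, with `ε₁ = min_k dist(pt k, ξ)/2`: for a pair `i < j` of the three marks, the
chords `(Ω; pt i, pt j)` of `R` and `(Ω'; pt i, pt j)` of `R'` (`MarkedDomain.chord`) are such a Dobrushin pair —
`q i, q j` is an endpoint approximation, and `Ω'` agrees with `Ω` on `B(pt k, dist(pt k, ξ) − ε)`, `k = i, j`,
because `Ω ∖ Ω' ⊆ B(ξ, ε)` (`inter_ball_eq_of_diff_subset_ball`).  So staffing stmt-1369 staffs STUB S1. -/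
theorem bumpAvoidanceLimits_of_avoidanceCocycleLimit
    (hA : Summit.CriticalPhenomena.SAWScalingLimit.Theses.SAWRestrictionRigidity.AvoidanceCocycleLimit) :
    BumpAvoidanceLimits := by
  intro R q hq hreach
  -- separation of ξ = pt 3 from the three marks u, v, w
  set d : ℝ := min (dist (R.pt 0) (R.pt 3)) (min (dist (R.pt 1) (R.pt 3)) (dist (R.pt 2) (R.pt 3)))
    with hd
  have hd0 : 0 < d := by
    refine lt_min ?_ (lt_min ?_ ?_) <;>
      exact dist_pos.2 fun h => absurd (R.pt_injective h) (by decide)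
  have hdk : ∀ k : Fin 3, d ≤ dist (R.pt k.castSucc) (R.pt 3) := by
    intro k
    fin_cases k
    · exact min_le_left _ _
    · exact (min_le_right _ _).trans (min_le_left _ _)
    · exact (min_le_right _ _).trans (min_le_right _ _)
  refine ⟨d / 2, half_pos hd0, ?_⟩
  intro R' ε hε hεd hsub hpt hball i j hij
  have hεi : ε < dist (R.pt i.castSucc) (R.pt 3) := by linarith [hdk i]
  have hεj : ε < dist (R.pt j.castSucc) (R.pt 3) := by linarith [hdk j]
  -- the Dobrushin pair `(Ω; pt i, pt j) ⊇ (Ω'; pt i, pt j)`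
  have hlt : i.castSucc < j.castSucc := Fin.castSucc_lt_castSucc_iff.2 hij
  set D : DobrushinDomain := R.chord i.castSucc j.castSucc hlt with hD
  set D' : DobrushinDomain := R'.chord i.castSucc j.castSucc hlt with hD'
  have happ : SAW.IsEndpointApprox D (q i) (q j) := ⟨hreach i j hij.ne, hq i, hq j⟩
  have hsub' : D'.carrier ⊆ D.carrier := hsub
  have h0 : D'.pt 0 = D.pt 0 := hpt i
  have h1 : D'.pt 1 = D.pt 1 := hpt j
  set ε' : ℝ := min (dist (R.pt i.castSucc) (R.pt 3) - ε) (dist (R.pt j.castSucc) (R.pt 3) - ε)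
    with hε'
  have hε'pos : 0 < ε' := lt_min (by linarith) (by linarith)
  have hεi' : ε + ε' ≤ dist (R.pt i.castSucc) (R.pt 3) := by
    have := min_le_left (dist (R.pt i.castSucc) (R.pt 3) - ε) (dist (R.pt j.castSucc) (R.pt 3) - ε)
    linarith
  have hεj' : ε + ε' ≤ dist (R.pt j.castSucc) (R.pt 3) := by
    have := min_le_right (dist (R.pt i.castSucc) (R.pt 3) - ε) (dist (R.pt j.castSucc) (R.pt 3) - ε)
    linarith
  have hagree : ∃ e : ℝ, 0 < e ∧
      D'.carrier ∩ Metric.ball (D.pt 0) e = D.carrier ∩ Metric.ball (D.pt 0) e ∧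
      D'.carrier ∩ Metric.ball (D.pt 1) e = D.carrier ∩ Metric.ball (D.pt 1) e := by
    refine ⟨ε', hε'pos, ?_, ?_⟩
    · show R'.carrier ∩ Metric.ball (R.pt i.castSucc) ε' = R.carrier ∩ Metric.ball (R.pt i.castSucc) ε'
      exact inter_ball_eq_of_diff_subset_ball hsub hball hεi'
    · show R'.carrier ∩ Metric.ball (R.pt j.castSucc) ε' = R.carrier ∩ Metric.ball (R.pt j.castSucc) ε'
      exact inter_ball_eq_of_diff_subset_ball hsub hball hεj'
  exact hA D D' (q i) (q j) happ hsub' h0 h1 hagree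

/-- Real-valued limit of the bump-hitting non-probability `h = 1 − P(avoid)`. -/
theorem tendsto_hit_of_tendsto_avoid {f : ℝ → ENNReal} {c : ENNReal} (hc : c ≠ ⊤)
    (h : Tendsto f (𝓝[>] (0 : ℝ)) (𝓝 c)) :
    Tendsto (fun δ => 1 - (f δ).toReal) (𝓝[>] (0 : ℝ)) (𝓝 (1 - c.toReal)) :=
  tendsto_const_nhds.sub ((ENNReal.tendsto_toReal hc).comp h)

/-- **The rank-one algebra.** If three numbers are, to relative precision `η ≤ 1/2`, an amplitude times the
squares `g₁², g₂², (g₁+g₂)²`, then their square roots are additive to relative precision `4η`, and the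
big one is positive. -/
theorem sqrt_additive_of_square_kernel {α g₁ g₂ η L₀₁ L₁₂ L₀₂ : ℝ}
    (hα : 0 < α) (hg₁ : 0 < g₁) (hg₂ : 0 < g₂) (hη0 : 0 ≤ η) (hη1 : η ≤ 1 / 2)
    (h₀₁ : |L₀₁ - α * g₁ ^ 2| ≤ η * (α * g₁ ^ 2))
    (h₁₂ : |L₁₂ - α * g₂ ^ 2| ≤ η * (α * g₂ ^ 2))
    (h₀₂ : |L₀₂ - α * (g₁ + g₂) ^ 2| ≤ η * (α * (g₁ + g₂) ^ 2)) :
    0 < L₀₂ ∧ |Real.sqrt L₀₂ - Real.sqrt L₀₁ - Real.sqrt L₁₂| ≤ 4 * η * Real.sqrt L₀₂ := by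
  -- square roots of the amplitude and of the slack factors
  set s := Real.sqrt α with hs
  set p := Real.sqrt (1 + η) with hp
  set m := Real.sqrt (1 - η) with hm
  have hs0 : 0 ≤ s := Real.sqrt_nonneg _
  have hp0 : 0 ≤ p := Real.sqrt_nonneg _
  have hm0 : 0 ≤ m := Real.sqrt_nonneg _
  have hs2 : s ^ 2 = α := Real.sq_sqrt hα.le
  have hp2 : p ^ 2 = 1 + η := Real.sq_sqrt (by linarith)
  have hm2 : m ^ 2 = 1 - η := Real.sq_sqrt (by linarith)
  -- two-sided bounds on the L's
  obtain ⟨h₀₁l, h₀₁u⟩ := abs_le.1 h₀₁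
  obtain ⟨h₁₂l, h₁₂u⟩ := abs_le.1 h₁₂
  obtain ⟨h₀₂l, h₀₂u⟩ := abs_le.1 h₀₂
  have hg : 0 < g₁ + g₂ := by linarith
  -- upper bounds √L ≤ p s g
  have up : ∀ {L g : ℝ}, 0 < g → L - α * g ^ 2 ≤ η * (α * g ^ 2) → Real.sqrt L ≤ p * s * g := by
    intro L g hg0 hL
    have h1 : L ≤ (p * s * g) ^ 2 := by
      have : (p * s * g) ^ 2 = (1 + η) * (α * g ^ 2) := by rw [mul_pow, mul_pow, hp2, hs2]; ring
      rw [this]; linarith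
    calc Real.sqrt L ≤ Real.sqrt ((p * s * g) ^ 2) := Real.sqrt_le_sqrt h1
      _ = p * s * g := Real.sqrt_sq (by positivity)
  -- lower bounds m s g ≤ √L
  have low : ∀ {L g : ℝ}, 0 < g → -(η * (α * g ^ 2)) ≤ L - α * g ^ 2 → m * s * g ≤ Real.sqrt L := by
    intro L g hg0 hL
    have h1 : (m * s * g) ^ 2 ≤ L := by
      have : (m * s * g) ^ 2 = (1 - η) * (α * g ^ 2) := by rw [mul_pow, mul_pow, hm2, hs2]; ring
      rw [this]; linarith
    exact (le_abs_self _).trans (Real.abs_le_sqrt h1)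
  have u02 := up hg h₀₂u
  have l02 := low hg h₀₂l
  have u01 := up hg₁ h₀₁u
  have l01 := low hg₁ h₀₁l
  have u12 := up hg₂ h₁₂u
  have l12 := low hg₂ h₁₂l
  -- p − m ≤ 2η and m ≥ 1/2
  have hp1 : 1 ≤ p := by
    rw [hp]; exact Real.one_le_sqrt.2 (by linarith)
  have hpm : m ≤ p := by
    rw [hm, hp]; exact Real.sqrt_le_sqrt (by linarith)
  have e3 : (p - m) * (p + m) = p ^ 2 - m ^ 2 := by ring
  rw [hp2, hm2] at e3
  have e4 : p - m ≤ (p - m) * (p + m) := le_mul_of_one_le_right (sub_nonneg.2 hpm) (by linarith)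
  have hpm2 : p - m ≤ 2 * η := by linarith
  have hmhalf : 1 / 2 ≤ m := by
    rw [hm]; exact (Real.le_sqrt (by norm_num) (by linarith)).2 (by norm_num; linarith)
  -- positivity of L₀₂
  have hL02 : 0 < L₀₂ := by
    have h1 : 0 < (1 - η) * (α * (g₁ + g₂) ^ 2) := mul_pos (by linarith) (by positivity)
    have h2 : (1 - η) * (α * (g₁ + g₂) ^ 2) = α * (g₁ + g₂) ^ 2 - η * (α * (g₁ + g₂) ^ 2) := by ring
    linarith
  refine ⟨hL02, ?_⟩
  -- |√L₀₂ − √L₀₁ − √L₁₂| ≤ (p − m) s (g₁ + g₂) ≤ 2η · 2√L₀₂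
  have hsg : s * (g₁ + g₂) ≤ 2 * Real.sqrt L₀₂ := by
    have h1 : 1 / 2 * (s * (g₁ + g₂)) ≤ m * (s * (g₁ + g₂)) :=
      mul_le_mul_of_nonneg_right hmhalf (mul_nonneg hs0 hg.le)
    have h2 : m * s * (g₁ + g₂) = m * (s * (g₁ + g₂)) := by ring
    linarith
  have e1 : (p - m) * (s * (g₁ + g₂)) = p * s * (g₁ + g₂) - m * s * g₁ - m * s * g₂ := by ring
  have e2 : -((p - m) * (s * (g₁ + g₂))) = m * s * (g₁ + g₂) - p * s * g₁ - p * s * g₂ := by ring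
  have hA : |Real.sqrt L₀₂ - Real.sqrt L₀₁ - Real.sqrt L₁₂| ≤ (p - m) * (s * (g₁ + g₂)) := by
    rw [abs_le]
    constructor
    · linarith
    · linarith
  calc |Real.sqrt L₀₂ - Real.sqrt L₀₁ - Real.sqrt L₁₂| ≤ (p - m) * (s * (g₁ + g₂)) := hA
    _ ≤ (2 * η) * (2 * Real.sqrt L₀₂) :=
        mul_le_mul hpm2 hsg (mul_nonneg hs0 hg.le) (by linarith)
    _ = 4 * η * Real.sqrt L₀₂ := by ring

/-! ## 4. The skeleton theorem: the two stubs imply the crux, BY NAME (kernel-checked, no `sorry` here) -/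

/-- **`RankOneBumps_of`: BumpAvoidanceLimits → WardSquareKernel → `RankOneBumps`.**  Glue: slack
`η' = min(η/8, 1/2)`; `ε₀ = min(ε₁, ε₀')` from (S1) and from (S2) at `(θ, η')`; for a bump `R', ε` the three
avoidance limits `c_ij` exist (S1) and are `≤ 1`, so `h_ij(δ) → L_ij = 1 − c_ij` in `ℝ`; (S2) gives
`|L_ij − α g_ij²| ≤ η' α g_ij²` with `g₀₂ = g₀₁ + g₁₂`, `g₀₁, g₁₂ > 0` (strict monotonicity of the charges); the
rank-one algebra gives `0 < L₀₂` and `|√L₀₂ − √L₀₁ − √L₁₂| ≤ 4η'√L₀₂ < η√L₀₂`; a strict inequality between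
limits holds eventually (`Filter.Tendsto.eventually_lt`).  Hypotheses = the two stubs under their registered
names; conclusion = the route decl, by name. -/
theorem RankOneBumps_of (hL : __Registered.stub_bumpAvoidanceLimits)
    (hW : __Registered.stub_wardSquareKernel) :
    Summit.CriticalPhenomena.SAWScalingLimit.Theses.SAWPtolemyBoundary.RankOneBumps := by
  intro R q hq hreach θ hθ η hη
  obtain ⟨ε₁, hε₁, hL⟩ := hL R q hq hreach
  obtain ⟨G, hG, hW⟩ := hW R q hq hreach
  -- slack η' with 4η' < η and η' ≤ 1/2
  set η' : ℝ := min (η / 8) (1 / 2) with hη'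
  have hη'pos : 0 < η' := lt_min (by linarith) (by norm_num)
  have hη'le : η' ≤ 1 / 2 := min_le_right _ _
  have hη'η : 4 * η' < η := by
    have := min_le_left (η / 8) (1 / 2); linarith
  obtain ⟨ε₂, hε₂, hW⟩ := hW θ hθ η' hη'pos
  refine ⟨min ε₁ ε₂, lt_min hε₁ hε₂, ?_⟩
  intro R' ε hε hεlt hsub hpt hbump hθbump
  have hεε₁ : ε < ε₁ := lt_of_lt_of_le hεlt (min_le_left _ _)
  have hεε₂ : ε < ε₂ := lt_of_lt_of_le hεlt (min_le_right _ _)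
  have hlim := hL R' ε hε hεε₁ hsub hpt hbump
  obtain ⟨α, hα, hK⟩ := hW R' ε hε hεε₂ hsub hpt hbump hθbump
  -- the three limits (S1)
  obtain ⟨c₀₂, ht₀₂⟩ := hlim 0 2 (by decide)
  obtain ⟨c₀₁, ht₀₁⟩ := hlim 0 1 (by decide)
  obtain ⟨c₁₂, ht₁₂⟩ := hlim 1 2 (by decide)
  -- the square-kernel estimates (S2) at the limits
  have k₀₂ := hK 0 2 (by decide) c₀₂ ht₀₂
  have k₀₁ := hK 0 1 (by decide) c₀₁ ht₀₁
  have k₁₂ := hK 1 2 (by decide) c₁₂ ht₁₂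
  have hg₁ : 0 < G 1 - G 0 := sub_pos.2 (hG (by decide))
  have hg₂ : 0 < G 2 - G 1 := sub_pos.2 (hG (by decide))
  have hsum : G 2 - G 0 = (G 1 - G 0) + (G 2 - G 1) := by ring
  rw [hsum] at k₀₂
  obtain ⟨hL02, hrank⟩ := sqrt_additive_of_square_kernel hα hg₁ hg₂ hη'pos.le hη'le k₀₁ k₁₂ k₀₂
  -- pass to the lattice: limits of both sides of the crux inequality
  have T₀₂ := tendsto_hit_of_tendsto_avoid (ne_top_of_tendsto_avoid ht₀₂) ht₀₂
  have T₀₁ := tendsto_hit_of_tendsto_avoid (ne_top_of_tendsto_avoid ht₀₁) ht₀₁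
  have T₁₂ := tendsto_hit_of_tendsto_avoid (ne_top_of_tendsto_avoid ht₁₂) ht₁₂
  have TL := ((T₀₂.sqrt.sub T₀₁.sqrt).sub T₁₂.sqrt).abs
  have TR := T₀₂.sqrt.const_mul η
  have hlt : |Real.sqrt (1 - c₀₂.toReal) - Real.sqrt (1 - c₀₁.toReal) - Real.sqrt (1 - c₁₂.toReal)| <
      η * Real.sqrt (1 - c₀₂.toReal) := by
    have hpos : 0 < Real.sqrt (1 - c₀₂.toReal) := Real.sqrt_pos.2 hL02
    calc _ ≤ 4 * η' * Real.sqrt (1 - c₀₂.toReal) := hrank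
      _ < η * Real.sqrt (1 - c₀₂.toReal) := mul_lt_mul_of_pos_right hη'η hpos
  exact (TL.eventually_lt TR hlt).mono fun δ h => h.le

/-- Wiring check (an `example`, so that `RankOneBumps_of` stays the only theorem concluding the crux): the
registered stubs, with their literal types, feed the skeleton theorem — this term becomes the crux proof when
the two `sorry`s above are discharged. -/
example : Summit.CriticalPhenomena.SAWScalingLimit.Theses.SAWPtolemyBoundary.RankOneBumps :=
  RankOneBumps_of stub_bumpAvoidanceLimits stub_wardSquareKernel

/-- Wiring check through the sibling item: stmt-1369 (`AvoidanceCocycleLimit`) and STUB S2 give the crux. -/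
example (hA : Summit.CriticalPhenomena.SAWScalingLimit.Theses.SAWRestrictionRigidity.AvoidanceCocycleLimit)
    (hW : WardSquareKernel) :
    Summit.CriticalPhenomena.SAWScalingLimit.Theses.SAWPtolemyBoundary.RankOneBumps :=
  RankOneBumps_of (bumpAvoidanceLimits_of_avoidanceCocycleLimit hA) hW

end Summit.CriticalPhenomena.SAWScalingLimit.Cruxes.RankOneBumps.Birth

end
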